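import Literature.NumberTheory.GaloisRepresentations.UnramifiedPeriodMatrix
import Literature.NumberTheory.PAdicHodge.UnramifiedCompletionEmbedding
import HarnessLib

/-!
# The unit period matrix of an unramified `p`-adic representation, read in `ℂ_F`

`Proofs`-style file (theorems only: no definition, no named fact, no instance).

**What is printed.**  Fontaine 1990, A1.2.6 / Fontaine–Ouyang Thm. 2.13, Prop. 2.14 / Serre,
*Local Fields* XIII §5 (Lang's theorem): an unramified `p`-adic representation `r` of `Γ_F` is
`F̂_nr`-admissible — there is an invertible matrix `X` over `𝒪̂_{F_nr}` with `X = R(σ) σ(X)`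
(tree: `exists_isUnit_forall_eq_mul_galAut`); a fortiori it is `ℂ_F`-admissible, reading `X` in
`ℂ_F ⊇ 𝒪̂_{F_nr}` through the `Γ_F`-equivariant embedding `ι : 𝒪̂_{F_nr} → ℂ_F` (tree:
`maxUnramifiedCompletion.toC`, `smul_toC`, `toC_algebraMap`; Sen 1980 / Fontaine Exp. III §1.5:
`ℂ_F`-admissibility).

**What is proved here.**  For a continuous unramified `r : Γ_F →ₜ* GL_N(ℤ_p)`:
* `exists_isUnit_forall_map_smul_eq_mul` — an invertible `Y ∈ M_N(ℂ_F)` with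
  `σ(Y) = R(σ⁻¹) Y` for all `σ ∈ Γ_F`, `R(σ)` the matrix `r σ` read in `ℂ_F` through
  `ℤ_p ⊆ ℚ_p → F → ℂ_F`;
* `exists_isUnit_forall_smul_col_eq_mulVec` — column form: every column `y` of `Y` is a
  *semi-invariant vector*, `σ(y) = R(σ⁻¹) y` (the shape consumed by the coordinate calculus of
  `SemiInvariantMultiplicationMatrix` and by Tate–Sen theory with coefficients).

## References

* J.-M. Fontaine, *Représentations p-adiques des corps locaux I* (1990), A1.2.6.
* J.-M. Fontaine, Y. Ouyang, *Theory of p-adic Galois representations* (2022 draft), Thm. 2.13,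
  Prop. 2.14. [`FontaineOuyang2022`]
* J.-P. Serre, *Local Fields*, GTM 67 (1979), Ch. XIII §5. [`SerreLocalFields1979`]
-/

noncomputable section

open ValuativeRel Field Matrix
open scoped MatrixGroups

namespace Literature.NumberTheory.PAdicHodge

open Literature.NumberTheory.GaloisRepresentations
open Literature.NumberTheory.GaloisRepresentations.IsNonarchimedeanLocalField

namespace UnramifiedUnitPeriods

variable {F : Type} [Field F] [ValuativeRel F] [TopologicalSpace F] [IsNonarchimedeanLocalField F]
  {p : ℕ} [Fact p.Prime] [Algebra ℚ_[p] F] {N : ℕ}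
  (r : absoluteGaloisGroup F →ₜ* GL (Fin N) ℤ_[p])

/-- `ι(R(σ)) = r σ` read in `ℂ_F` through `ℤ_p ⊆ ℚ_p → F → ℂ_F`. [folklore] -/
private theorem map_toC_periodCoeff (σ : absoluteGaloisGroup F) :
    (periodCoeff (p := p) r σ).map (maxUnramifiedCompletion.toC F) =
      ((r σ : GL (Fin N) ℤ_[p]) : Matrix (Fin N) (Fin N) ℤ_[p]).map
        (fun a : ℤ_[p] => algebraMap F (CompletedAlgClosure F) (algebraMap ℚ_[p] F (a : ℚ_[p]))) := by
  ext i j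
  simp only [Matrix.map_apply, RingHom.mapMatrix_apply, padicIntToCompletion, RingHom.coe_comp,
    Function.comp_apply, toC_algebraMap, coe_padicIntToInteger]

/-- `ι(σ(X)) = σ(ι(X))` entrywise (`ι` is `Γ_F`-equivariant). [folklore] -/
private theorem map_toC_galAut_mapMatrix (σ : absoluteGaloisGroup F)
    (X : Matrix (Fin N) (Fin N) (maxUnramifiedCompletion F)) :
    ((maxUnramifiedCompletion.galAut F σ).toRingHom.mapMatrix X).map (maxUnramifiedCompletion.toC F) =
      (X.map (maxUnramifiedCompletion.toC F)).map (σ • ·) := by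
  ext i j
  simp only [Matrix.map_apply, RingHom.mapMatrix_apply, RingEquiv.toRingHom_eq_coe,
    RingHom.coe_coe, smul_toC]

/-- `R(σ⁻¹) R(σ) = 1` in `ℂ_F`. [folklore] -/
private theorem map_inv_mul_map (σ : absoluteGaloisGroup F) :
    ((r σ⁻¹ : GL (Fin N) ℤ_[p]) : Matrix (Fin N) (Fin N) ℤ_[p]).map
        (fun a : ℤ_[p] => algebraMap F (CompletedAlgClosure F) (algebraMap ℚ_[p] F (a : ℚ_[p]))) *
      ((r σ : GL (Fin N) ℤ_[p]) : Matrix (Fin N) (Fin N) ℤ_[p]).map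
        (fun a : ℤ_[p] => algebraMap F (CompletedAlgClosure F) (algebraMap ℚ_[p] F (a : ℚ_[p]))) = 1 := by
  have hf : (fun a : ℤ_[p] => algebraMap F (CompletedAlgClosure F) (algebraMap ℚ_[p] F (a : ℚ_[p]))) =
      ⇑(((algebraMap F (CompletedAlgClosure F)).comp (algebraMap ℚ_[p] F)).comp
        (PadicInt.Coe.ringHom (p := p))) := by
    funext a; rfl
  rw [hf, ← Matrix.map_mul, ← Units.val_mul, ← map_mul, inv_mul_cancel, map_one, Units.val_one,
    Matrix.map_one _ (map_zero _) (map_one _)]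

/-- **Unit periods of an unramified representation, in `ℂ_F`.**  For a continuous unramified
`r : Γ_F →ₜ* GL_N(ℤ_p)` there is an invertible `Y ∈ M_N(ℂ_F)` with `σ(Y) = R(σ⁻¹) · Y` for every
`σ ∈ Γ_F` (`σ` acting entrywise, `R(τ)` = `r τ` read in `ℂ_F`): the image in `ℂ_F` of the period
matrix `X = R(σ) σ(X)` over `𝒪̂_{F_nr}` given by Lang's theorem. [cite: SerreLocalFields1979, Ch. XIII §5]
[cite: FontaineOuyang2022, Thm. 2.13 and Prop. 2.14] -/
theorem exists_isUnit_forall_map_smul_eq_mul (hr : ∀ σ ∈ absInertia F, r σ = 1) :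
    ∃ Y : Matrix (Fin N) (Fin N) (CompletedAlgClosure F), IsUnit Y ∧
      ∀ σ : absoluteGaloisGroup F, Y.map (σ • ·) =
        ((r σ⁻¹ : GL (Fin N) ℤ_[p]) : Matrix (Fin N) (Fin N) ℤ_[p]).map
          (fun a : ℤ_[p] => algebraMap F (CompletedAlgClosure F) (algebraMap ℚ_[p] F (a : ℚ_[p]))) * Y := by
  obtain ⟨X, hXu, hX⟩ := exists_isUnit_forall_eq_mul_galAut (p := p) r hr
  refine ⟨X.map (maxUnramifiedCompletion.toC F), hXu.map (maxUnramifiedCompletion.toC F).mapMatrix,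
    fun σ => ?_⟩
  -- `Y = R(σ) σ(Y)` in `ℂ_F`
  have h1 : X.map (maxUnramifiedCompletion.toC F) =
      ((r σ : GL (Fin N) ℤ_[p]) : Matrix (Fin N) (Fin N) ℤ_[p]).map
          (fun a : ℤ_[p] => algebraMap F (CompletedAlgClosure F) (algebraMap ℚ_[p] F (a : ℚ_[p]))) *
        (X.map (maxUnramifiedCompletion.toC F)).map (σ • ·) := by
    conv_lhs => rw [hX σ]
    rw [Matrix.map_mul, map_toC_periodCoeff, map_toC_galAut_mapMatrix]
  -- multiply by `R(σ⁻¹)`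
  have h2 := congrArg (((r σ⁻¹ : GL (Fin N) ℤ_[p]) : Matrix (Fin N) (Fin N) ℤ_[p]).map
    (fun a : ℤ_[p] => algebraMap F (CompletedAlgClosure F) (algebraMap ℚ_[p] F (a : ℚ_[p]))) * ·) h1
  beta_reduce at h2
  rw [← mul_assoc, map_inv_mul_map, one_mul] at h2
  exact h2.symm

/-- **Column form.**  With `Y` as above, every column `y = Y e_i` is semi-invariant:
`σ(y) = R(σ⁻¹) y` for all `σ ∈ Γ_F`, and `Y` is invertible. [cite: SerreLocalFields1979, Ch. XIII §5]
[cite: FontaineOuyang2022, Thm. 2.13 and Prop. 2.14] -/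
theorem exists_isUnit_forall_smul_col_eq_mulVec (hr : ∀ σ ∈ absInertia F, r σ = 1) :
    ∃ Y : Matrix (Fin N) (Fin N) (CompletedAlgClosure F), IsUnit Y ∧
      ∀ (σ : absoluteGaloisGroup F) (i : Fin N), (fun k => σ • Y k i) =
        ((r σ⁻¹ : GL (Fin N) ℤ_[p]) : Matrix (Fin N) (Fin N) ℤ_[p]).map
          (fun a : ℤ_[p] => algebraMap F (CompletedAlgClosure F) (algebraMap ℚ_[p] F (a : ℚ_[p]))) *ᵥ
          fun k => Y k i := by
  obtain ⟨Y, hYu, hY⟩ := exists_isUnit_forall_map_smul_eq_mul r hr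
  refine ⟨Y, hYu, fun σ i => funext fun k => ?_⟩
  have h := congrFun (congrFun (hY σ) k) i
  rw [Matrix.map_apply] at h
  rw [h, Matrix.mul_apply, Matrix.mulVec, dotProduct]

end UnramifiedUnitPeriods

end Literature.NumberTheory.PAdicHodge

end
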